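import Literature.IUT.LogVolume.Corollary22PartIILemmas
import Literature.IUT.LogVolume.Corollary22OfPartII
import HarnessLib

/-!
# [IUTchIV] §2 with an EXPONENT: Cor. 2.2 / Cor. 2.3 bookkeeping for a display of Theorem 1.10
# DILATED by a factor `Λ ≥ 1` (the "`With`" predicates)

Mochizuki, *Inter-universal Teichmüller theory IV*, RIMS manuscript (Apr. 2020; = PRIMS **57** (2021)),
Thm. 1.10 (pp. 22–23), Cor. 2.2 (statement pp. 41–43, proof of (ii) pp. 43–48), Cor. 2.3 (pp. 54–55).
STATEMENTS file (definitions + the elementary bookkeeping they support); TAKES NO SIDE on the disputed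
step ([IUTchIII] Cor. 3.12 ⇒ Thm. 1.10): every display below is a HYPOTHESIS shape, typed, never asserted.

## What and why

The record chain `Cor22.Thm110Legendre → Cor22.PartII → Cor22.Corollary22 → [GenEll] Thm. 2.1 (ii)_{Σ={2}}
→ abc` (`Corollary22Legendre.lean`, `Corollary22PartII.lean`, `Corollary22OfThm110.lean`, `Corollary23Chain.lean`)
transports print's display of Theorem 1.10,
`(1/6)·log(q) ≤ (1 + 20·d_mod/l)·(log(𝔡^{F_tpd}) + log(𝔣^{F_tpd})) + 20·(d*_mod·l + η_prm)` (p. 46 l. 1),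
to the abc inequality with exponent `1 + ε`. Several conditional lines of the tree deliver instead a
DILATED display `(1/6)·(μ·log(q)) ≤ [same right-hand side]` with a fixed `0 < μ ≤ 1` (a multiplicative
loss in front of `log(q)`; e.g. the "off-Σ tolerance" shape `B ≤ κ·T.gap + Tol`, `μ = 1 − κ`). Dividing by
`μ` this is print's display with the WHOLE right-hand side multiplied by `Λ := 1/μ ≥ 1`. This file types
the `Λ`-dilated versions of the record predicates — ONE coefficient convention throughout: `Λ` multiplies
the whole right-hand side (constants of BD-classes excepted) —

* `DisplayWith P l η Λ` — `(1/6)·log(q^{∤{2,l}}) ≤ Λ·((1 + 20·d_mod/l)·(log-diff + log(𝔣)) + 20·(d*_mod·l + η))`;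
* `Thm110LegendreWith Λ` — `Thm110Legendre` with `DisplayWith … Λ` as conclusion;
* `ConditionsC1C2With d C_K P l Λ`, `PartIIWith K_V H_unif Λ`, `Corollary22With Λ H_unif` — Cor. 2.2 (ii) and
  Cor. 2.2 with the last inequality of (C2) replaced by
  `(1/6)·log(q^∀) ≤ Λ·(1 + Λ³·ε_E)·(log-diff_X + log-cond_D) + C_K`                                   (C2)_Λ
  (parts (i) and (iii) are print's, unchanged — they are PROVED in the tree: `partI_holds`,
  `exists_threshold_partIII_of_partI`);

and PROVES the bookkeeping of the proof of Cor. 2.3 (p. 55) in this currency: (i) + (ii)_Λ + (iii) give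
`ht_{ω_P(C)} ≲ Λ·(1+ε)·(log-diff + log-cond)` on `K_V ∩ U_P(ℚ̄)^{≤d}` for EVERY `ε > 0` (`bdLe_of_corollary22With`;
the `Λ³` in (C2)_Λ is immaterial here because (iii) makes `ε_E` arbitrarily small off a finite set), the
monotonicity of `PartIIWith` in `H_unif` and the assembly `(∀ K_V, (ii)_Λ) ⟹ ∃ H_unif, Corollary22With Λ H_unif`,
plus the `Λ = 1` regressions as kernel `iff`s (`displayWith_one_iff`, `thm110LegendreWith_one_iff`,
`conditionsC1C2With_one_iff`, `partIIWith_one_iff`, `corollary22With_one_iff`).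

## The one non-mechanical point: why (C2)_Λ carries `Λ³·ε_E` and not `ε_E`

In print's arithmetic (pp. 46–48; the tree's `Cor22.Data`, `Corollary22Arithmetic.lean`) the term
`20·d*_mod·l` of the display is bounded through (P1) by `(1/6)·h·(2/5)·ε_E` and MOVED TO THE LEFT, after which one
divides by `1 − (2/5)·ε_E ≥ 3/5`. With the display dilated by `Λ` that term is `Λ·(1/6)·h·(2/5)·ε_E`, the divisor
is `1 − Λ·(2/5)·ε_E`, and the quotient `(1 + ε_E/5)/(1 − Λ·(2/5)·ε_E)` exceeds `1 + ε_E` as soon as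
`Λ·(1 + ε_E) > 2`: a factor of `Λ` inside the `ε`-slot is forced. The companion proof file
(`Corollary22PartIIWith.lean`) runs print's arithmetic VERBATIM (the record `Cor22.Data`, reused, not
re-proved) with `δ ↦ Λ·δ`, `L ↦ Λ·L`, `η_prm ↦ Λ·η_prm`, `d*_mod ↦ Λ·d*_mod` — every field of `Cor22.Data` still
holds — which yields (C2)_Λ with `ε_E(Λδ) ≤ Λ³·ε_E(δ)` (`log Λ ≤ Λ − 1`) in the main case and the exceptional
bound `h < (16/ε_d)³·(60Λδ)^{4+ε_d} ≤ Λ⁵·2^{137}·ε_d^{−3}·d^{4+ε_d}` otherwise (so `H_unif := 2^{140}·Λ⁵` there).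

Deliberately NOT here: any proof of (ii)_Λ (companion file), the abc/Vojta predicates with exponent
([GenEll] side, `GenEllThm21With.lean`) and the endpoint `Thm110LegendreWith Λ → … → abc with exponent Λ`
(`Corollary22OfThm110With.lean`). Nothing here asserts that any display (dilated or not) holds at any
datum, or that abc (with any exponent) is proved or refuted.
-/

noncomputable section

namespace Literature.IUT.LogVolume

namespace Cor22

open NumberField IsDedekindDomain Literature.NumberTheory.DiophantineGeometry.GenEll

/-! ## The dilated display of Theorem 1.10 and the dilated interface `Thm110LegendreWith` -/

/-- **The display of [IUTchIV] Thm. 1.10 as applied on p. 46 l. 1, DILATED by the factor `Λ`** (the whole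
right-hand side multiplied by `Λ`; `Λ = 1` is print's `Cor22.Display`, `displayWith_one_iff`):
`(1/6)·log(q^{∤{2,l}}(λ)) ≤ Λ·((1 + 20·d_mod/l)·(log-diff_X(x_E) + log(𝔣^{F_tpd})) + 20·(d*_mod·l + η))`,
`d*_mod = 2^{12}·3^3·5·d_mod`. For `Λ = 1/μ` this is the "dilated display" `(1/6)·(μ·log(q)) ≤ [print's RHS]`
(`displayWith_one_div_of_dilated`). A hypothesis SHAPE; nothing asserts it at any point.
[claim: Mochizuki2012, status: disputed] -/
def DisplayWith (P : NFPoint) (l : ℕ) (η Λ : ℝ) : Prop :=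
  1 / 6 * logQAvoid P {2, l} ≤
    Λ * ((1 + 20 * (dmod P : ℝ) / l) * (P.logDiff + logCondAvoid P {2, l})
      + 20 * (2 ^ 12 * 3 ^ 3 * 5 * (dmod P : ℝ) * l + η))

/-- `Λ = 1` regression: `DisplayWith P l η 1 ↔ Display P l η` (print's display, p. 46 l. 1).
[claim: Mochizuki2012, status: disputed] -/
theorem displayWith_one_iff (P : NFPoint) (l : ℕ) (η : ℝ) : DisplayWith P l η 1 ↔ Display P l η := by
  unfold DisplayWith Display
  rw [one_mul]

/-- The right-hand side of the display is `≥ 0` for `η ≥ 0` (`log-diff ≥ 0`, `log(𝔣) ≥ 0`, `d_mod ≥ 0`).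
[claim: Mochizuki2012, status: disputed] -/
theorem display_rhs_nonneg (P : NFPoint) (l : ℕ) {η : ℝ} (hη : 0 ≤ η) :
    0 ≤ (1 + 20 * (dmod P : ℝ) / l) * (P.logDiff + logCondAvoid P {2, l})
      + 20 * (2 ^ 12 * 3 ^ 3 * 5 * (dmod P : ℝ) * l + η) := by
  have h1 : 0 ≤ P.logDiff := P.logDiff_nonneg
  have h2 : 0 ≤ logCondAvoid P {2, l} := logCondAvoid_nonneg P _
  have h3 : (0 : ℝ) ≤ (dmod P : ℝ) := Nat.cast_nonneg _
  have h4 : (0 : ℝ) ≤ (l : ℝ) := Nat.cast_nonneg _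
  have h5 : 0 ≤ 20 * (dmod P : ℝ) / l := by positivity
  positivity

/-- `DisplayWith` is MONOTONE in `Λ` (for `η ≥ 0`): a larger dilation factor is a weaker display.
[claim: Mochizuki2012, status: disputed] -/
theorem DisplayWith.mono {P : NFPoint} {l : ℕ} {η Λ Λ' : ℝ} (hη : 0 ≤ η) (hΛΛ' : Λ ≤ Λ')
    (h : DisplayWith P l η Λ) : DisplayWith P l η Λ' := by
  unfold DisplayWith at h ⊢
  exact h.trans (mul_le_mul_of_nonneg_right hΛΛ' (display_rhs_nonneg P l hη))

/-- Print's display implies the dilated one for every `Λ ≥ 1` (`η ≥ 0`). [claim: Mochizuki2012, status: disputed] -/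
theorem DisplayWith.of_display {P : NFPoint} {l : ℕ} {η Λ : ℝ} (hη : 0 ≤ η) (hΛ : 1 ≤ Λ)
    (h : Display P l η) : DisplayWith P l η Λ :=
  ((displayWith_one_iff P l η).2 h).mono hη hΛ

/-- **Glue for the dilated displays of the conditional lines.** If `(1/6)·(μ·log(q^{∤{2,l}})) ≤ [print's RHS]`
with `0 < μ`, then `DisplayWith P l η (1/μ)`. (This is the shape delivered, e.g., from an off-Σ tolerance
`B ≤ κ·T.gap + Tol` with `μ = 1 − κ`.) [claim: Mochizuki2012, status: disputed] -/
theorem displayWith_one_div_of_dilated {P : NFPoint} {l : ℕ} {η μ : ℝ} (hμ : 0 < μ)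
    (h : 1 / 6 * (μ * logQAvoid P {2, l}) ≤
      (1 + 20 * (dmod P : ℝ) / l) * (P.logDiff + logCondAvoid P {2, l})
        + 20 * (2 ^ 12 * 3 ^ 3 * 5 * (dmod P : ℝ) * l + η)) :
    DisplayWith P l η (1 / μ) := by
  unfold DisplayWith
  rw [← div_le_iff₀' (by positivity : (0 : ℝ) < 1 / μ)]
  calc 1 / 6 * logQAvoid P {2, l} / (1 / μ) = 1 / 6 * (μ * logQAvoid P {2, l}) := by
        field_simp
    _ ≤ _ := h

/-- The same glue with the dilation written as `μ·((1/6)·log(q))`. [claim: Mochizuki2012, status: disputed] -/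
theorem displayWith_one_div_of_dilated' {P : NFPoint} {l : ℕ} {η μ : ℝ} (hμ : 0 < μ)
    (h : μ * (1 / 6 * logQAvoid P {2, l}) ≤
      (1 + 20 * (dmod P : ℝ) / l) * (P.logDiff + logCondAvoid P {2, l})
        + 20 * (2 ^ 12 * 3 ^ 3 * 5 * (dmod P : ℝ) * l + η)) :
    DisplayWith P l η (1 / μ) :=
  displayWith_one_div_of_dilated hμ (by rw [← mul_assoc, mul_comm (1 / 6) μ, mul_assoc]; exact h)

/-- Conversely, `DisplayWith P l η Λ` with `0 < Λ` is the dilated display with `μ = 1/Λ`.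
[claim: Mochizuki2012, status: disputed] -/
theorem DisplayWith.dilated {P : NFPoint} {l : ℕ} {η Λ : ℝ} (hΛ : 0 < Λ) (h : DisplayWith P l η Λ) :
    1 / 6 * (1 / Λ * logQAvoid P {2, l}) ≤
      (1 + 20 * (dmod P : ℝ) / l) * (P.logDiff + logCondAvoid P {2, l})
        + 20 * (2 ^ 12 * 3 ^ 3 * 5 * (dmod P : ℝ) * l + η) := by
  unfold DisplayWith at h
  have h' := (div_le_iff₀' hΛ).2 h
  calc 1 / 6 * (1 / Λ * logQAvoid P {2, l}) = 1 / 6 * logQAvoid P {2, l} / Λ := by ring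
    _ ≤ _ := h'

/-- **`Thm110LegendreWith Λ` — what the proof of Cor. 2.2 (ii) takes from Theorem 1.10, with the display
DILATED by `Λ`**: for every `η_prm` (Prop. 1.6), every `λ ∈ U_X` minimally presented, every prime `l ≥ 5`,
under "admits an `F`-core", (P2), (P5), (P6), the dilated display `DisplayWith P l η Λ` holds. `Λ = 1` is the
record interface `Cor22.Thm110Legendre` (`thm110LegendreWith_one_iff`). HYPOTHESIS shape (it rests, for
`Λ = 1`, on [IUTchIII] Cor. 3.12; for `Λ > 1` it is what a conditional "loss" line would deliver); never
asserted here. [claim: Mochizuki2012, status: disputed] -/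
def Thm110LegendreWith (Λ : ℝ) : Prop :=
  ∀ η : ℝ, IsEtaPrm η → ∀ P : NFPoint, P ∈ UP → ∀ l : ℕ, l.Prime → 5 ≤ l →
    AdmitsCore P → CondP2 P l → CondP5 P l → CondP6 P l → DisplayWith P l η Λ

/-- `Λ = 1` regression: `Thm110LegendreWith 1 ↔ Thm110Legendre`. [claim: Mochizuki2012, status: disputed] -/
theorem thm110LegendreWith_one_iff : Thm110LegendreWith 1 ↔ Thm110Legendre := by
  unfold Thm110LegendreWith Thm110Legendre
  simp only [displayWith_one_iff]

/-- `Thm110LegendreWith` is MONOTONE in `Λ`. [claim: Mochizuki2012, status: disputed] -/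
theorem Thm110LegendreWith.mono {Λ Λ' : ℝ} (hΛΛ' : Λ ≤ Λ') (h : Thm110LegendreWith Λ) :
    Thm110LegendreWith Λ' :=
  fun η hη P hP l hl h5 hc h2 h5' h6 => (h η hη P hP l hl h5 hc h2 h5' h6).mono hη.1.le hΛΛ'

/-- The record interface implies the dilated one for every `Λ ≥ 1`. [claim: Mochizuki2012, status: disputed] -/
theorem Thm110LegendreWith.of_thm110Legendre {Λ : ℝ} (hΛ : 1 ≤ Λ) (h : Thm110Legendre) :
    Thm110LegendreWith Λ :=
  (thm110LegendreWith_one_iff.2 h).mono hΛ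

/-! ## Corollary 2.2 (ii) and Corollary 2.2 with the exponent `Λ` -/

/-- **Conditions (C1), (C2)_Λ** for the point `x_E`, the prime `l` and the constant `C_K` (p. 42, with the
exponent `Λ` carried): (C1) verbatim — `(log(q^∀))^{1/2} ≤ l ≤ 10δ·(log(q^∀))^{1/2}·log(2δ·log(q^∀))`;
(C2)_Λ — `(1/6)·log(q) ≤ (1/6)·log(q^{∤2}) ≤ (1/6)·log(q^∀) ≤ Λ·(1 + Λ³·ε_E)·(log-diff_X(x_E) + log-cond_D(x_E)) + C_K`
(`ε_E` print's, `Cor22.epsilonE`; the `Λ³` is the cost of running print's `ε_E`-absorption with `δ ↦ Λδ`, see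
the module docstring). `Λ = 1` is print's `ConditionsC1C2` (`conditionsC1C2With_one_iff`).
[claim: Mochizuki2012, status: disputed] -/
def ConditionsC1C2With (d : ℕ) (CK : ℝ) (P : NFPoint) (l : ℕ) (Λ : ℝ) : Prop :=
  Real.sqrt (logQForall P) ≤ l ∧
    (l : ℝ) ≤ 10 * delta d * Real.sqrt (logQForall P) * Real.log (2 * delta d * logQForall P) ∧
  1 / 6 * logQAvoid P {2, l} ≤ 1 / 6 * logQNotTwo P ∧ 1 / 6 * logQNotTwo P ≤ 1 / 6 * logQForall P ∧
    1 / 6 * logQForall P ≤ Λ * ((1 + Λ ^ 3 * epsilonE d P) * (P.logDiff + P.logCond)) + CK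

/-- `Λ = 1` regression: `ConditionsC1C2With d C_K P l 1 ↔ ConditionsC1C2 d C_K P l`.
[claim: Mochizuki2012, status: disputed] -/
theorem conditionsC1C2With_one_iff (d : ℕ) (CK : ℝ) (P : NFPoint) (l : ℕ) :
    ConditionsC1C2With d CK P l 1 ↔ ConditionsC1C2 d CK P l := by
  unfold ConditionsC1C2With ConditionsC1C2
  simp only [one_pow, one_mul]

/-- **Cor. 2.2 (ii) with the exponent `Λ`** for `K_V` and the uniform constant `H_unif`: print's (ii) (pp. 41–43,
typed as `Cor22.PartII`: constants `C_K, H_K > 0`; for `d ≥ 1`, `0 < ε_d ≤ 1` a finite-through-minimal-polynomials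
exceptional set `Exc_d ⊆ U_X(ℚ̄)^{≤d}` containing the points of `K_V` with `j ∈ {0, 1728}`, on which
`log(q^∀) ≤ H_unif·ε_d^{−3}·d^{4+ε_d} + H_K`, and off which some prime `l ≥ 5` satisfies (C1), (C2)) with
(C2) replaced by (C2)_Λ (`ConditionsC1C2With … Λ`). `Λ = 1` is `Cor22.PartII` (`partIIWith_one_iff`).
Typed, never asserted. [claim: Mochizuki2012, status: disputed] -/
def PartIIWith (D : CBData) (Hunif Λ : ℝ) : Prop :=
  ∃ CK HK : ℝ, 0 < CK ∧ 0 < HK ∧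
    ∀ d : ℕ, 1 ≤ d → ∀ εd : ℝ, 0 < εd → εd ≤ 1 →
      ∃ Exc : Set NFPoint, HasFinitelyManyPoints Exc ∧ Exc ⊆ UPle d ∧
        (∀ P ∈ D.toSet ∩ UPle d, (jInv P.x = 0 ∨ jInv P.x = 1728) → P ∈ Exc) ∧
        (∀ P ∈ Exc, logQForall P ≤ Hunif * εd ^ (-(3 : ℝ)) * (d : ℝ) ^ (4 + εd) + HK) ∧
        ∀ P ∈ D.toSet ∩ UPle d, P ∉ Exc →
          ∃ l : ℕ, l.Prime ∧ 5 ≤ l ∧ ConditionsC1C2With d CK P l Λ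

/-- `Λ = 1` regression: `PartIIWith K_V H_unif 1 ↔ PartII K_V H_unif`. [claim: Mochizuki2012, status: disputed] -/
theorem partIIWith_one_iff (D : CBData) (Hunif : ℝ) : PartIIWith D Hunif 1 ↔ PartII D Hunif := by
  unfold PartIIWith PartII
  simp only [conditionsC1C2With_one_iff]

/-- **[IUTchIV] Corollary 2.2 with the exponent `Λ`**, for a given uniform constant `H_unif > 0`: for every
compactly bounded `K_V ⊆ U_X(ℚ̄)` whose support contains `2` and which satisfies (∗^{j-inv}), parts (i) [print's,
`Cor22.PartI` — PROVED in the tree], (ii)_Λ [`PartIIWith`] and (iii) [print's, `Cor22.PartIII` — PROVED in the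
tree above an absolute threshold] hold. `Λ = 1` is `Cor22.Corollary22` (`corollary22With_one_iff`). A predicate;
nothing is asserted. [claim: Mochizuki2012, status: disputed] -/
def Corollary22With (Λ Hunif : ℝ) : Prop :=
  0 < Hunif ∧ ∀ D : CBData, Hypotheses D → PartI D ∧ PartIIWith D Hunif Λ ∧ PartIII D Hunif

/-- `Λ = 1` regression: `Corollary22With 1 H_unif ↔ Corollary22 H_unif`. [claim: Mochizuki2012, status: disputed] -/
theorem corollary22With_one_iff (Hunif : ℝ) : Corollary22With 1 Hunif ↔ Corollary22 Hunif := by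
  unfold Corollary22With Corollary22
  simp only [partIIWith_one_iff]

/-! ## The bookkeeping of the proof of Corollary 2.3 (p. 55), with the exponent `Λ` -/

/-- **The Cor. 2.2 step of the proof of Cor. 2.3 (p. 55), with the exponent `Λ ≥ 1`**: (i) + (ii)_Λ + (iii) for
`K_V` give, for every `d ≥ 1` and EVERY `ε > 0`, the inequality of BD-classes
`ht_{ω_P(C)} ≲ Λ·(1+ε)·(log-diff_P + log-cond_C)` on `K_V ∩ U_P(ℚ̄)^{≤d}` — statement (ii) of [GenEll] Thm. 2.1 for
this `K_V` with the factor `Λ` carried (the WHOLE right-hand side multiplied by `Λ`). Proof as in print /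
`bdLe_of_corollary22`: off the exceptional sets of (ii)_Λ (at `ε_d := 1`) and of (iii) (at `ε_d := 1` and
`ε' := min(ε,1)/Λ³`, so that `Λ³·ε_E ≤ ε` there) chain `ht ≤ (1/6)·log(q^∀) + C₀` [(i)] with (C2)_Λ; on them
`log(q^∀)` is bounded. [claim: Mochizuki2012, status: disputed] -/
theorem bdLe_of_corollary22With {Λ : ℝ} (hΛ : 1 ≤ Λ) {D : CBData} {Hunif : ℝ} (hI : PartI D)
    (hII : PartIIWith D Hunif Λ) (hIII : PartIII D Hunif) {d : ℕ} (hd : 1 ≤ d) {ε : ℝ} (hε : 0 < ε) :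
    BDLe (D.toSet ∩ UPle d) NFPoint.ht (fun P => Λ * ((1 + ε) * (P.logDiff + P.logCond))) := by
  obtain ⟨CK, HK, hCKpos, _, hII⟩ := hII
  obtain ⟨HK₃, _, hIII⟩ := hIII
  have hΛ0 : 0 < Λ := lt_of_lt_of_le one_pos hΛ
  have hΛ3 : 1 ≤ Λ ^ 3 := one_le_pow₀ hΛ
  have hΛ30 : 0 < Λ ^ 3 := by positivity
  -- exceptional sets for `ε_d := 1` and `ε' := min ε 1 / Λ³`
  set ε' : ℝ := min ε 1 / Λ ^ 3 with hε'
  have hm0 : 0 < min ε 1 := lt_min hε one_pos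
  have hε'0 : 0 < ε' := div_pos hm0 hΛ30
  have hε'1 : ε' ≤ 1 := by
    rw [hε', div_le_one hΛ30]
    exact (min_le_right _ _).trans hΛ3
  have hε'ε : Λ ^ 3 * ε' ≤ ε := by
    rw [hε', mul_div_cancel₀ _ hΛ30.ne']
    exact min_le_left _ _
  obtain ⟨Exc₁, -, -, -, hB₁, hC⟩ := hII d hd 1 one_pos le_rfl
  obtain ⟨Exc₂, -, -, hB₂, hE⟩ := hIII d hd 1 one_pos le_rfl ε' hε'0 hε'1
  -- from (i): `ht ≤ (1/6) log(q^∀) + C₀` on `K_V`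
  obtain ⟨_, h12, h23⟩ := hI
  have hht : BDLe D.toSet NFPoint.ht (fun P => 1 / 6 * logQForall P) :=
    (h23.symm.trans h12.symm).bdLe
  obtain ⟨C₀, hC₀⟩ := hht
  -- the bounds for `log(q^∀)` ON the exceptional sets, and the chain OFF them
  set B₁ : ℝ := Hunif * (1 : ℝ) ^ (-(3 : ℝ)) * (d : ℝ) ^ (4 + (1 : ℝ)) + HK with hB₁def
  set B₂ : ℝ := Hunif * ε' ^ (-(3 : ℝ)) * (1 : ℝ) ^ (-(3 : ℝ)) * (d : ℝ) ^ (4 + (1 : ℝ)) + HK₃ with hB₂def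
  refine ⟨C₀ + CK + (|B₁| + |B₂|) / 6, fun P hP => ?_⟩
  obtain ⟨hPD, hPd⟩ := hP
  have h0 := hC₀ P hPD
  have hLC : 0 ≤ P.logDiff + P.logCond := add_nonneg P.logDiff_nonneg P.logCond_nonneg
  have hε1 : 0 ≤ Λ * ((1 + ε) * (P.logDiff + P.logCond)) :=
    mul_nonneg hΛ0.le (mul_nonneg (by linarith) hLC)
  have hCK : 0 ≤ CK := le_of_lt hCKpos
  have hA₁ : B₁ ≤ |B₁| := le_abs_self _
  have hA₂ : B₂ ≤ |B₂| := le_abs_self _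
  have hA₁' : 0 ≤ |B₁| := abs_nonneg _
  have hA₂' : 0 ≤ |B₂| := abs_nonneg _
  simp only at h0 ⊢
  by_cases hP1 : P ∈ Exc₁
  · have hq : logQForall P ≤ B₁ := hB₁ P hP1
    linarith
  by_cases hP2 : P ∈ Exc₂
  · have hq : logQForall P ≤ B₂ := hB₂ P hP2
    linarith
  obtain ⟨l, -, -, -, -, -, -, hC2⟩ := hC P ⟨hPD, hPd⟩ hP1
  have hεE : epsilonE d P ≤ ε' := hE P ⟨hPD, hPd⟩ hP2
  have hεE' : Λ ^ 3 * epsilonE d P ≤ ε := (mul_le_mul_of_nonneg_left hεE hΛ30.le).trans hε'ε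
  have hmono : Λ * ((1 + Λ ^ 3 * epsilonE d P) * (P.logDiff + P.logCond)) ≤
      Λ * ((1 + ε) * (P.logDiff + P.logCond)) :=
    mul_le_mul_of_nonneg_left (mul_le_mul_of_nonneg_right (by linarith) hLC) hΛ0.le
  linarith

/-- `PartIIWith` is MONOTONE in `H_unif` (the uniform constant only enters the admissible bound for `log(q^∀)`
on the exceptional set `Exc_d`). [claim: Mochizuki2012, status: disputed] -/
theorem partIIWith_mono {D : CBData} {H H' Λ : ℝ} (hHH' : H ≤ H') (h : PartIIWith D H Λ) :
    PartIIWith D H' Λ := by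
  obtain ⟨CK, HK, hCK, hHK, h⟩ := h
  refine ⟨CK, HK, hCK, hHK, fun d hd εd h0 h1 => ?_⟩
  obtain ⟨Exc, hfin, hsub, hCM, hB, hC⟩ := h d hd εd h0 h1
  refine ⟨Exc, hfin, hsub, hCM, fun P hP => ?_, hC⟩
  have hM : 0 ≤ εd ^ (-(3 : ℝ)) * (d : ℝ) ^ (4 + εd) :=
    mul_nonneg (Real.rpow_nonneg h0.le _) (Real.rpow_nonneg (Nat.cast_nonneg d) _)
  have := hB P hP
  have hmono : H * εd ^ (-(3 : ℝ)) * (d : ℝ) ^ (4 + εd) ≤ H' * εd ^ (-(3 : ℝ)) * (d : ℝ) ^ (4 + εd) := by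
    have key := mul_le_mul_of_nonneg_right hHH' hM
    calc H * εd ^ (-(3 : ℝ)) * (d : ℝ) ^ (4 + εd) = H * (εd ^ (-(3 : ℝ)) * (d : ℝ) ^ (4 + εd)) := by ring
      _ ≤ H' * (εd ^ (-(3 : ℝ)) * (d : ℝ) ^ (4 + εd)) := key
      _ = H' * εd ^ (-(3 : ℝ)) * (d : ℝ) ^ (4 + εd) := by ring
  linarith

/-- **Assembly of Cor. 2.2 with the exponent `Λ` from its parts**: if (i) holds for every `K_V` satisfying the
hypotheses of Cor. 2.2 and (ii)_Λ holds for every such `K_V` with SOME uniform constant `H_II`, then — (iii)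
being PROVED in the tree for all `H_unif ≥ H₃` from (i) (`exists_threshold_partIII_of_partI`) — there is an
`H_unif` (namely `max(H_II, H₃, 1)`) with `Corollary22With Λ H_unif`. [claim: Mochizuki2012, status: disputed] -/
theorem exists_corollary22With_of_partI_partIIWith {Λ : ℝ} (hI : ∀ D : CBData, Hypotheses D → PartI D)
    {HII : ℝ} (hII : ∀ D : CBData, Hypotheses D → PartIIWith D HII Λ) :
    ∃ Hunif : ℝ, Corollary22With Λ Hunif := by
  obtain ⟨H₃, hH₃, h3⟩ := exists_threshold_partIII_of_partI
  refine ⟨max (max HII H₃) 1, lt_of_lt_of_le one_pos (le_max_right _ _), fun D hD => ?_⟩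
  have hI' := hI D hD
  exact ⟨hI', partIIWith_mono (le_trans (le_max_left _ _) (le_max_left _ _)) (hII D hD),
    h3 D hI' _ (le_trans (le_max_right _ _) (le_max_left _ _))⟩

/-- **Cor. 2.2 with the exponent `Λ` from its part (ii)_Λ alone**: part (i) being PROVED for every `K_V` with
the printed hypotheses (`partI_holds`) and (iii) following from (i), `(∀ K_V, PartIIWith K_V H_II Λ) ⟹
∃ H_unif, Corollary22With Λ H_unif`. [claim: Mochizuki2012, status: disputed] -/
theorem exists_corollary22With_of_partIIWith {Λ HII : ℝ}
    (hII : ∀ D : CBData, Hypotheses D → PartIIWith D HII Λ) : ∃ Hunif : ℝ, Corollary22With Λ Hunif :=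
  exists_corollary22With_of_partI_partIIWith partI_holds hII

end Cor22

end Literature.IUT.LogVolume

end
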